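import Summits.AnomalousDissipation.AnomalousDissipation.Theses.SolenoidalFractalHomogenisation
import Summits.AnomalousDissipation.AnomalousDissipation.Theorems.IsotropicCubatureWord
import Summits.AnomalousDissipation.AnomalousDissipation.Theorems.SolenoidalFractalHomogenisationRealisedQuasiStaticCellLawLowerLaw
import Summits.AnomalousDissipation.AnomalousDissipation.Theorems.SolenoidalFractalHomogenisationRealisedQuasiStaticCellLawUpperGlue
import Summits.AnomalousDissipation.AnomalousDissipation.Theorems.SolenoidalFractalHomogenisationRealisedQuasiStaticCellLawUpperSome
import HarnessLib

/-!
# K2R `RealisedQuasiStaticCellLaw` (stmt-AnomalousDissipation-20446), line `floquet-bloch`: the by-name closer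

Summits-side file (everything proved; no definitions, no named facts). The kernel-checked composition of the registered
skeleton r20 of line `floquet-bloch` (sha16 5d75d3efc45ae287): witness word = the 26-slot cubature word `cubatureWord`
with its nominal constant `c0` (`isotropicWordGain_cubatureWord`); for each `δ` the LOWER side for every weak solution is
`lowerLaw` (…LowerLaw: road stubs Strong / WeakFar / WeakNear + sector glue + weak uniqueness) and the UPPER side is
`upperLaw_of_upperSome` (…UpperGlue) applied to the T2 lane's `upperSome` (…UpperSome, p607736 = the registered stub
`stub_upperSome` verbatim: mirrored slaved-ladder functional + first-order cone + two-point Jensen isotropy + Galerkin transfer); both sides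
are realised at the common pre-stretch `max M₁ M₂` (the stubs are monotone in the pre-stretch by statement) and the
regimes are merged (`ν₀ = min`, `K = max`) by `wordGainAtRate_one_mono` / `upperModeLaw_mono`.
-/

set_option linter.dupNamespace false

noncomputable section

namespace Summit.AnomalousDissipation.AnomalousDissipation.Theorems.SolenoidalFractalHomogenisation.RealisedQuasiStaticCellLaw

open Set MeasureTheory
open scoped InnerProductSpace
open Literature.Analysis Literature.Analysis.FunctionSpaces Literature.Analysis.FunctionSpaces.Torus
open Literature.Analysis.FluidPDE Literature.Analysis.FluidPDE.LatticeShear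
open Summit.AnomalousDissipation.AnomalousDissipation.Theses.SolenoidalFractalHomogenisation (RealisedQuasiStaticCellLaw)

/-- **K2R `RealisedQuasiStaticCellLaw` from the registered stubs of line `floquet-bloch`.** Witness: the cubature word
with its nominal constant `c0`; for each `δ` the common pre-stretch `max M₁ M₂`; regimes merged by monotonicity;
every-solution universality from the weak uniqueness `stub_cellUnique` (inside `lowerLaw` / `upperLaw_of_upperSome`). -/
theorem RealisedQuasiStaticCellLaw_of : RealisedQuasiStaticCellLaw := by
  refine ⟨26, cubatureWord, c0, c0_pos, isotropicWordGain_cubatureWord, ?_⟩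
  intro δ hδ
  obtain ⟨M₁, hM₁, H₁⟩ := lowerLaw δ hδ
  obtain ⟨M₂, hM₂, H₂⟩ := upperLaw_of_upperSome upperSome δ hδ
  have hM : 0 < max M₁ M₂ := lt_max_of_lt_left hM₁
  obtain ⟨ν₁, hν₁, K₁, hK₁, L⟩ := H₁ (max M₁ M₂) hM (le_max_left _ _)
  obtain ⟨ν₂, hν₂, K₂, hK₂, U⟩ := H₂ (max M₁ M₂) hM (le_max_right _ _)
  refine ⟨max M₁ M₂, hM, min ν₁ ν₂, lt_min hν₁ hν₂, max K₁ K₂, lt_max_of_lt_left hK₁, ?_, ?_⟩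
  · exact wordGainAtRate_one_mono _ _ _ _ _ _ (min_le_left _ _) (le_max_left _ _) L
  · exact upperModeLaw_mono _ _ _ _ _ _ hK₂ (min_le_right _ _) (le_max_right _ _) U

end Summit.AnomalousDissipation.AnomalousDissipation.Theorems.SolenoidalFractalHomogenisation.RealisedQuasiStaticCellLaw

end
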